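import Summits.MatrixMultiplication.OmegaCensus.STPPKernelListerOrderN41A

/-!
# ω-census (abelian STPP census): kernel lister — ORDER capstones for the order `n = 41`, part B (second half of the root computation + the theorem) (data + kernel computation + theorem)

HONEST FRAMING (pub-omega census; verbatim): lottery ticket; floor = certified bounds/negative ranges.
Census STRUCTURE (seat pub-omega-stpp-2 gen 30, 2026-08-29), family (b2).  Nothing here is progress on `ω` — the theorems EXCLUDE: for each order `n`
treated here, EVERY finite abelian group `H` of order `n` and every STPP family of `H` (CKSU Def. 5.1, the tree's `IsSTPP`) has `Σ |Aᵢ||Bᵢ||Cᵢ| ≤ n`,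
so CKSU Thm. 5.5 gives no bound below `3` from `H`.  Mechanism: the kernel lister (`STPPKernelListerDefs`) run with the EMPTY dead list — the tree laws
alone (single-block volume, representation count, N7, N16, N8 = Kneser over all divisors of `n`, N18, N12; all block counts, all entries) prune every
beating size pattern — fed to the dead-list-free capstone `KLister.volume_le_of_scan_nodead` (`STPPKernelListerOrderKit`).  Per order: the packed
bound tables `chunksN<n>` (python twin `gen_order.py` / `klister_lean.py`, checkpoint 16, base 512), their kernel certificate `chunksOK_N<n>`, shape-list
completeness `chunksN<n>_flat`, the root computation `scan_N<n>` (`decide +kernel`), and the theorem `volume_le_of_card_eq_<n>`.  This part: the root computation over the first blocks NOT in `sel1N41` (twin 95642 of 178135 calls; 147 beating leaves reached in total, all rejected by the tree-law filters) and `volume_le_of_card_eq_41` via `volume_le_of_scan_or_nodead`.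
-/

open Finset

namespace Summit.MatrixMultiplication.OmegaCensus.KLister

open Literature.Computability.AlgebraicComplexity

set_option maxRecDepth 32768 in
set_option maxHeartbeats 4000000 in
/-- Root computation of the kernel lister at order `41`, EMPTY dead list, first blocks outside `sel1N41`: `true` (twin 95642 calls). [folklore] -/
theorem scanB_N41 : scanFirstC 41 [] (fun s => !(sel1N41.contains s)) chunksN41 = true := by
  decide +kernel

/-- **Every abelian group of order `41` admits no beating STPP family — KERNEL:** for every finite abelian group `H` with `|H| = 41`, every `m`
and every simultaneous-triple-product family `(Aᵢ, Bᵢ, Cᵢ)_{i<m}` of `H` (CKSU Def. 5.1), `Σᵢ |Aᵢ||Bᵢ||Cᵢ| ≤ 41` — so CKSU Thm. 5.5 yields no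
`ω < 3` from any abelian group of order `41`. [cite: CohnKleinbergSzegedyUmans2005, Def. 5.1, Thm. 5.5] -/
theorem volume_le_of_card_eq_41 {H : Type*} [AddCommGroup H] [Fintype H] [DecidableEq H] (hH : Fintype.card H = 41)
    {m : ℕ} (A B C : Fin m → Finset H) (hS : IsSTPP A B C) : ∑ i, #(A i) * #(B i) * #(C i) ≤ 41 :=
  volume_le_of_scan_or_nodead hH (by norm_num) chunksN41 (fun s => sel1N41.contains s) (fun s => !(sel1N41.contains s)) chunksOK_N41
    adm_chunksN41 chunksN41_flat (List.all_eq_true.2 fun s _ => Bool.or_not_self _)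
    scanA_N41 scanB_N41 A B C hS

end Summit.MatrixMultiplication.OmegaCensus.KLister
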